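import Mathlib.LinearAlgebra.Matrix.DotProduct
import Literature.Analysis.FluidPDE.FiniteFourierModeEuler

/-!
# Kishimoto–Yoneda, §2: vector algebra, the pair bracket, Beltrami vectors (definitions)

Support file for `FiniteFourierModeEuler` (N. Kishimoto, T. Yoneda, *Characterization of
three-dimensional Euler flows supported on finitely many Fourier modes*, J. Math. Fluid Mech.
24 (2022) 74 = arXiv:2110.08039). Everything here is PROVED; the file only sets up vocabulary:

* coordinate API for `KY.cplx`, `KY.dot` (= Mathlib `dotProduct`), `KY.proj` (`P̂_n`):
  bilinearity, `|m|² P̂_m v = |m|² v - (m·v) m` (`dot_smul_proj`), `m · P̂_m v = 0`, linearity,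
  behaviour under `v ↦ v̄`, `m ↦ -m`;
* the PAIR BRACKET `bracket n₁ n₂ u₁ u₂ = (u₁·n₂) u₂ + (u₂·n₁) u₁` (the summand of (1.3), §2) and
  NON-INTERACTION `NonInteracting n₁ n₂ u₁ u₂ :↔ P̂_{n₁+n₂} bracket = 0` (the paper's (2.3) =
  (cond1)), with the symmetries `(1 ↔ 2)` and `(n, u) ↦ (-n, ū)` (real-valuedness), and
  **Prop. 2.2 (i)**: linearly dependent frequencies never interact (`bracket_eq_zero_of_cross_eq_zero`);
* BELTRAMI VECTORS `IsBV μ n u` (Def. 4.2 (ii)): `u ≠ 0`, `n·u = 0`, `i (n × u) = μ u`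
  (`μ = |n|`: `BV⁺`, `μ = -|n|`: `BV⁻`).

Lemma 2.1 / Prop. 2.2 (ii),(iii) are in `FiniteFourierModeEulerPair`, the Beltrami-vector facts
(Remark 4.3) in `FiniteFourierModeEulerBeltrami`.

## References

* [KishimotoYoneda2022] N. Kishimoto, T. Yoneda, J. Math. Fluid Mech. 24 (2022) 74 =
  arXiv:2110.08039, §1 (before (1.3)), §2 (Lemma 2.1, Prop. 2.2), §4 Def. 4.2 (ii).
-/

noncomputable section

open Matrix

namespace Literature.Analysis.FluidPDE

namespace KY

/-! ### Coordinate API for `cplx`, `dot`, `proj` -/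

/-- [folklore] -/
theorem cplx_apply (n : Fin 3 → ℝ) (i : Fin 3) : cplx n i = (n i : ℂ) := rfl

/-- `KY.dot` is Mathlib's `dotProduct`. [folklore] -/
theorem dot_eq_dotProduct (a b : Fin 3 → ℂ) : dot a b = a ⬝ᵥ b := rfl

/-- [folklore] -/
theorem dot_eq (a b : Fin 3 → ℂ) : dot a b = a 0 * b 0 + a 1 * b 1 + a 2 * b 2 := by
  simp [dot, Fin.sum_univ_three]

/-- [folklore] -/
theorem dot_comm (a b : Fin 3 → ℂ) : dot a b = dot b a := by
  rw [dot_eq, dot_eq]; ring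

/-- [folklore] -/
theorem dot_add_left (a b c : Fin 3 → ℂ) : dot (a + b) c = dot a c + dot b c := by
  simp only [dot_eq, Pi.add_apply]; ring

/-- [folklore] -/
theorem dot_add_right (a b c : Fin 3 → ℂ) : dot a (b + c) = dot a b + dot a c := by
  simp only [dot_eq, Pi.add_apply]; ring

/-- [folklore] -/
theorem dot_sub_right (a b c : Fin 3 → ℂ) : dot a (b - c) = dot a b - dot a c := by
  simp only [dot_eq, Pi.sub_apply]; ring

/-- [folklore] -/
theorem dot_smul_left (c : ℂ) (a b : Fin 3 → ℂ) : dot (c • a) b = c * dot a b := by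
  simp only [dot_eq, Pi.smul_apply, smul_eq_mul]; ring

/-- [folklore] -/
theorem dot_smul_right (c : ℂ) (a b : Fin 3 → ℂ) : dot a (c • b) = c * dot a b := by
  simp only [dot_eq, Pi.smul_apply, smul_eq_mul]; ring

/-- [folklore] -/
@[simp] theorem dot_zero_right (a : Fin 3 → ℂ) : dot a 0 = 0 := by
  simp [dot_eq]

/-- [folklore] -/
@[simp] theorem dot_zero_left (a : Fin 3 → ℂ) : dot 0 a = 0 := by
  simp [dot_eq]

/-- [folklore] -/
theorem dot_neg_right (a b : Fin 3 → ℂ) : dot a (-b) = -dot a b := by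
  simp only [dot_eq, Pi.neg_apply]; ring

/-- [folklore] -/
theorem dot_sum_right {ι : Type*} (a : Fin 3 → ℂ) (s : Finset ι) (v : ι → Fin 3 → ℂ) :
    dot a (∑ i ∈ s, v i) = ∑ i ∈ s, dot a (v i) := by
  classical
  induction s using Finset.induction_on with
  | empty => simp
  | insert x s hx ih => rw [Finset.sum_insert hx, Finset.sum_insert hx, dot_add_right, ih]

/-- [folklore] -/
theorem real_dot_eq (a b : Fin 3 → ℝ) : a ⬝ᵥ b = a 0 * b 0 + a 1 * b 1 + a 2 * b 2 := by
  simp [dotProduct, Fin.sum_univ_three]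

/-- [folklore] -/
theorem dot_cplx_cplx (a b : Fin 3 → ℝ) : dot (cplx a) (cplx b) = ((a ⬝ᵥ b : ℝ) : ℂ) := by
  rw [dot_eq, real_dot_eq]; simp [cplx_apply]

/-- [folklore] -/
theorem cplx_add (a b : Fin 3 → ℝ) : cplx (a + b) = cplx a + cplx b := by
  ext i; simp [cplx_apply]

/-- [folklore] -/
theorem cplx_neg (a : Fin 3 → ℝ) : cplx (-a) = -cplx a := by
  ext i; simp [cplx_apply]

/-- [folklore] -/
theorem cplx_sub (a b : Fin 3 → ℝ) : cplx (a - b) = cplx a - cplx b := by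
  ext i; simp [cplx_apply]

/-- [folklore] -/
theorem cplx_smul (c : ℝ) (a : Fin 3 → ℝ) : cplx (c • a) = (c : ℂ) • cplx a := by
  ext i; simp [cplx_apply]

/-- [folklore] -/
@[simp] theorem cplx_zero : cplx (0 : Fin 3 → ℝ) = 0 := by
  ext i; simp [cplx_apply]

/-- [folklore] -/
theorem cplx_eq_zero_iff (a : Fin 3 → ℝ) : cplx a = 0 ↔ a = 0 := by
  constructor
  · intro h; ext i; have := congrFun h i; simpa [cplx_apply] using this
  · rintro rfl; exact cplx_zero

/-- [folklore] -/
theorem star_cplx (a : Fin 3 → ℝ) : star (cplx a) = cplx a := by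
  ext i; simp [cplx_apply]

/-- [folklore] -/
theorem cplx_cross (a b : Fin 3 → ℝ) : cplx (a ⨯₃ b) = cplx a ⨯₃ cplx b := by
  ext i; fin_cases i <;> simp [cplx_apply, cross_apply]

/-- A vector in `ℂ³` (or `ℝ³`) is determined by its three coordinates. [folklore] -/
theorem vec3_eq_iff {R : Type*} (v w : Fin 3 → R) : v = w ↔ v 0 = w 0 ∧ v 1 = w 1 ∧ v 2 = w 2 := by
  constructor
  · rintro rfl; exact ⟨rfl, rfl, rfl⟩
  · rintro ⟨h0, h1, h2⟩; ext i; fin_cases i <;> assumption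

/-- [folklore] -/
theorem real_dot_self_ne_zero {n : Fin 3 → ℝ} (hn : n ≠ 0) : n ⬝ᵥ n ≠ 0 :=
  fun h => hn (dotProduct_self_eq_zero.1 h)

/-- [folklore] -/
theorem dot_cplx_self_ne_zero {n : Fin 3 → ℝ} (hn : n ≠ 0) : dot (cplx n) (cplx n) ≠ 0 := by
  rw [dot_cplx_cplx]; exact_mod_cast real_dot_self_ne_zero hn

/-- Clearing the denominator in `P̂_m`: `|m|² P̂_m v = |m|² v - (m·v) m`.
[cite: KishimotoYoneda2022, §1 (before (1.3))] -/
theorem dot_smul_proj {m : Fin 3 → ℝ} (hm : m ≠ 0) (v : Fin 3 → ℂ) :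
    dot (cplx m) (cplx m) • proj m v = dot (cplx m) (cplx m) • v - dot (cplx m) v • cplx m := by
  have h := dot_cplx_self_ne_zero hm
  simp only [proj, smul_sub, smul_smul]
  rw [mul_div_cancel₀ _ h]

/-- `P̂_m` kills `m`-components: `m · P̂_m v = 0`. [cite: KishimotoYoneda2022, §1] -/
theorem dot_proj {m : Fin 3 → ℝ} (hm : m ≠ 0) (v : Fin 3 → ℂ) : dot (cplx m) (proj m v) = 0 := by
  have h := dot_cplx_self_ne_zero hm
  simp only [proj, dot_sub_right, dot_smul_right]
  rw [div_mul_cancel₀ _ h, sub_self]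

/-- `P̂_m v = v` when `m · v = 0`. [cite: KishimotoYoneda2022, §1 ("`P̂_n u_n = u_n`")] -/
theorem proj_eq_self_of_dot_eq_zero (m : Fin 3 → ℝ) {v : Fin 3 → ℂ} (hv : dot (cplx m) v = 0) :
    proj m v = v := by
  simp [proj, hv]

/-- `P̂_m` is `ℂ`-linear: additivity. [folklore] -/
theorem proj_add (m : Fin 3 → ℝ) (v w : Fin 3 → ℂ) : proj m (v + w) = proj m v + proj m w := by
  simp only [proj, dot_eq, Pi.add_apply]
  rw [show ∀ a b c d : Fin 3 → ℂ, a + b - c = (a - d) + (b - (c - d)) from fun a b c d => by abel]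
  congr 1
  rw [← sub_smul, ← sub_div]
  congr 2; ring

/-- `P̂_m` is `ℂ`-linear: homogeneity. [folklore] -/
theorem proj_smul (m : Fin 3 → ℝ) (c : ℂ) (v : Fin 3 → ℂ) : proj m (c • v) = c • proj m v := by
  simp only [proj, dot_eq, Pi.smul_apply, smul_eq_mul, smul_sub, smul_smul]
  congr 2; ring

/-- [folklore] -/
@[simp] theorem proj_zero (m : Fin 3 → ℝ) : proj m 0 = 0 := by
  simp [proj, dot_eq]

/-- [folklore] -/
theorem proj_neg (m : Fin 3 → ℝ) (v : Fin 3 → ℂ) : proj m (-v) = -proj m v := by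
  rw [← neg_one_smul ℂ v, proj_smul, neg_one_smul]

/-- [folklore] -/
theorem proj_sum {ι : Type*} (m : Fin 3 → ℝ) (s : Finset ι) (v : ι → Fin 3 → ℂ) :
    proj m (∑ i ∈ s, v i) = ∑ i ∈ s, proj m (v i) := by
  classical
  induction s using Finset.induction_on with
  | empty => simp
  | insert a s ha ih => rw [Finset.sum_insert ha, Finset.sum_insert ha, proj_add, ih]

/-! ### The pair bracket and non-interaction (the paper's (2.3) = (cond1)) -/

/-- The symmetrised interaction of the modes `u₁ e^{i n₁·x}`, `u₂ e^{i n₂·x}` at frequency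
`n₁ + n₂`: `(u₁·n₂) u₂ + (u₂·n₁) u₁`. [cite: KishimotoYoneda2022, §2 Lemma 2.1] -/
def bracket (n₁ n₂ : Fin 3 → ℝ) (u₁ u₂ : Fin 3 → ℂ) : Fin 3 → ℂ :=
  dot u₁ (cplx n₂) • u₂ + dot u₂ (cplx n₁) • u₁

/-- The two modes DO NOT INTERACT: `P̂_{n₁+n₂}[(u₁·n₂)u₂ + (u₂·n₁)u₁] = 0` (condition (2.3) of
Proposition 2.2). [cite: KishimotoYoneda2022, §2 Prop. 2.2 (2.3)] -/
def NonInteracting (n₁ n₂ : Fin 3 → ℝ) (u₁ u₂ : Fin 3 → ℂ) : Prop :=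
  proj (n₁ + n₂) (bracket n₁ n₂ u₁ u₂) = 0

/-- [cite: KishimotoYoneda2022, §2 Lemma 2.1] -/
theorem bracket_comm (n₁ n₂ : Fin 3 → ℝ) (u₁ u₂ : Fin 3 → ℂ) :
    bracket n₂ n₁ u₂ u₁ = bracket n₁ n₂ u₁ u₂ := by
  simp only [bracket]; abel

/-- [cite: KishimotoYoneda2022, §2 Prop. 2.2] -/
theorem nonInteracting_comm (n₁ n₂ : Fin 3 → ℝ) (u₁ u₂ : Fin 3 → ℂ) :
    NonInteracting n₂ n₁ u₂ u₁ ↔ NonInteracting n₁ n₂ u₁ u₂ := by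
  simp only [NonInteracting, bracket_comm, add_comm n₂ n₁]

/-- Real-valuedness symmetry: conjugating both vectors and negating both frequencies conjugates
and negates the bracket. [cite: KishimotoYoneda2022, §1 (real-valuedness)] -/
theorem bracket_neg_star (n₁ n₂ : Fin 3 → ℝ) (u₁ u₂ : Fin 3 → ℂ) :
    bracket (-n₁) (-n₂) (star u₁) (star u₂) = -star (bracket n₁ n₂ u₁ u₂) := by
  rw [vec3_eq_iff]
  simp only [bracket, dot_eq, cplx_apply, Pi.add_apply, Pi.smul_apply, Pi.neg_apply, Pi.star_apply,
    smul_eq_mul, Complex.star_def, map_add, map_mul, Complex.conj_ofReal, Complex.ofReal_neg]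
  refine ⟨?_, ?_, ?_⟩ <;> ring

/-- [folklore] -/
theorem proj_star (m : Fin 3 → ℝ) (v : Fin 3 → ℂ) : proj m (star v) = star (proj m v) := by
  rw [vec3_eq_iff]
  simp only [proj, dot_eq, cplx_apply, Pi.sub_apply, Pi.smul_apply, Pi.star_apply, smul_eq_mul,
    Complex.star_def, map_sub, map_mul, map_div₀, map_add, Complex.conj_ofReal]
  exact ⟨trivial, trivial, trivial⟩

/-- [folklore] -/
theorem proj_neg_freq (m : Fin 3 → ℝ) (v : Fin 3 → ℂ) : proj (-m) v = proj m v := by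
  rw [vec3_eq_iff]
  simp only [proj, dot_eq, cplx_apply, Pi.sub_apply, Pi.smul_apply, Pi.neg_apply, smul_eq_mul,
    Complex.ofReal_neg]
  refine ⟨?_, ?_, ?_⟩ <;> ring

/-- Non-interaction is invariant under `(n_j, u_j) ↦ (-n_j, ū_j)` (the real-valuedness symmetry
`u_{-n} = ū_n`). [cite: KishimotoYoneda2022, §1] -/
theorem nonInteracting_neg_star_iff (n₁ n₂ : Fin 3 → ℝ) (u₁ u₂ : Fin 3 → ℂ) :
    NonInteracting (-n₁) (-n₂) (star u₁) (star u₂) ↔ NonInteracting n₁ n₂ u₁ u₂ := by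
  simp only [NonInteracting, bracket_neg_star, ← neg_add, proj_neg_freq, proj_neg, proj_star,
    neg_eq_zero, star_eq_zero]

/-- **Proposition 2.2 (i):** linearly dependent non-zero frequencies never interact — in fact the
bracket itself vanishes. [cite: KishimotoYoneda2022, §2 Prop. 2.2 (i)] -/
theorem bracket_eq_zero_of_cross_eq_zero {n₁ n₂ : Fin 3 → ℝ} {u₁ u₂ : Fin 3 → ℂ}
    (hn₁ : n₁ ≠ 0) (hn₂ : n₂ ≠ 0) (hk : n₁ ⨯₃ n₂ = 0)
    (hu₁ : dot (cplx n₁) u₁ = 0) (hu₂ : dot (cplx n₂) u₂ = 0) : bracket n₁ n₂ u₁ u₂ = 0 := by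
  have hdep : ¬ LinearIndependent ℝ ![n₁, n₂] := by
    intro h; exact (crossProduct_ne_zero_iff_linearIndependent.2 h) hk
  rw [LinearIndependent.pair_iff' hn₁] at hdep
  simp only [not_forall, not_not] at hdep
  obtain ⟨c, hc⟩ := hdep
  have hc0 : c ≠ 0 := by rintro rfl; exact hn₂ (by rw [← hc]; simp)
  have h1 : dot u₁ (cplx n₂) = 0 := by
    rw [← hc, cplx_smul, dot_smul_right, dot_comm, hu₁, mul_zero]
  have h2 : dot u₂ (cplx n₁) = 0 := by
    rw [← hc, cplx_smul, dot_smul_left] at hu₂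
    rcases mul_eq_zero.1 hu₂ with h | h
    · exact absurd (by exact_mod_cast h) hc0
    · rw [dot_comm]; exact h
  simp [bracket, h1, h2]

/-- [cite: KishimotoYoneda2022, §2 Prop. 2.2 (i)] -/
theorem nonInteracting_of_cross_eq_zero {n₁ n₂ : Fin 3 → ℝ} {u₁ u₂ : Fin 3 → ℂ}
    (hn₁ : n₁ ≠ 0) (hn₂ : n₂ ≠ 0) (hk : n₁ ⨯₃ n₂ = 0)
    (hu₁ : dot (cplx n₁) u₁ = 0) (hu₂ : dot (cplx n₂) u₂ = 0) : NonInteracting n₁ n₂ u₁ u₂ := by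
  simp [NonInteracting, bracket_eq_zero_of_cross_eq_zero hn₁ hn₂ hk hu₁ hu₂]


/-! ### Beltrami vectors (Definition 4.2 (ii), Remark 4.3 (iii), (iv)) -/

/-- `u` is a BELTRAMI VECTOR at the frequency `n` with eigenvalue `μ`: `u ≠ 0`, `n · u = 0` and
`i (n × u) = μ u` (so `u e^{in·x}` is an eigenfield of curl with eigenvalue `μ`; `μ = +|n|`,
`-|n|` are the paper's `BV⁺`, `BV⁻`). [cite: KishimotoYoneda2022, §4 Def. 4.2 (ii)] -/
def IsBV (μ : ℝ) (n : Fin 3 → ℝ) (u : Fin 3 → ℂ) : Prop :=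
  u ≠ 0 ∧ dot (cplx n) u = 0 ∧ Complex.I • (cplx n ⨯₃ u) = (μ : ℂ) • u

/-- [cite: KishimotoYoneda2022, §4 Def. 4.2 (ii)] -/
theorem IsBV.ne_zero {μ : ℝ} {n : Fin 3 → ℝ} {u : Fin 3 → ℂ} (h : IsBV μ n u) : u ≠ 0 := h.1

/-- [cite: KishimotoYoneda2022, §4 Def. 4.2 (ii)] -/
theorem IsBV.dot_eq_zero {μ : ℝ} {n : Fin 3 → ℝ} {u : Fin 3 → ℂ} (h : IsBV μ n u) :
    dot (cplx n) u = 0 := h.2.1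

/-- [cite: KishimotoYoneda2022, §4 Def. 4.2 (ii)] -/
theorem IsBV.eq {μ : ℝ} {n : Fin 3 → ℝ} {u : Fin 3 → ℂ} (h : IsBV μ n u) :
    Complex.I • (cplx n ⨯₃ u) = (μ : ℂ) • u := h.2.2

end KY

end Literature.Analysis.FluidPDE
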